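/-
Copyright (c) 2026 the pub-hodgecm-mathlib formalisation cell (harness21).  Prover seat hodgecm-mathlib-R90-CS-p03 (g3), R90-TF section S8 «ContSpec-n½» (dealer R90-CS-plan (g3);
structural finding F-A32 of census `R90/S8/CENSUS-A32-FiniteHalfOfRecord.R90-CS-p03-g3.md`, export (E-cell)): the big-cell CONJUGATION `Φ₃·u(x,z)·Φ₃ = n⁻(x,z)` (ring-generic) and
the VALUED CRITERION «a lower unitriangular `n⁻ = (1 0 0; a 1 0; b d 1)` lies in `B·K(c)` iff `|a|, |b|, |d| ≤ c`» (any valued field, radius `c < 1`) — so that the (E-supp) section read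
at the base point `w₀` is a TEST WEIGHT on the `𝔫_v`-ball (★ (a-4) ∕ ★ p864169 currency).
-/
import Summits.HodgeConjecture.HodgeConjecture.Theorems.K2E1BigCellIwasawaTorusEntryU3   -- ★ p863210 (R90-C10-p07 (g2)) FILE 1: ring-generic big-cell currency `!![1, x, z; 0, 1, -σ x; 0, 0, 1]`, `Φ₃`
import Literature.NumberTheory.Automorphic.GLnAdelicStructure                             -- ★ `valuedCongruenceSubgroup` (`K(c)`: `g`, `g⁻¹` integral, `g ≡ 1 mod {v ≤ c}`)
import HarnessLib

/-!
# K2·E1 ∕ R90·S8 — `K2E1BigCellConjugateCongruenceU3` (export (E-cell)): `Φ₃·u(x,z)·Φ₃` IS LOWER UNITRIANGULAR, AND A LOWER UNITRIANGULAR MATRIX LIES IN `B·K(c)` IFF ITS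
# THREE LOWER ENTRIES HAVE VALUATION `≤ c`

Cell `pub/hodgecm-mathlib`, crux h413 = `stmt-HodgeConjecture-24833`, route of record `HCCMUnconditional`; R90-TF section S8 «ContSpec-n½», road R2-χ₃ (★ F5's row `hA32`, finite half
`hA32f`; structural finding F-A32, repair (R1) «base point `g₁ := ι_f(w₀^{S₀})`»).  THEOREMS ONLY (no `def`, no `instance`, no notation, no named-fact hypothesis, no `sorry`; default
heartbeats); lane `--supports stmt-HodgeConjecture-24833 --as helper` (count-neutral).  Closes no socket.

THE MATHEMATICS ([Rogawski1990] §1.10 p. 9, §4.5 p. 45; [MoeglinWaldspurger1995] I.2.2, II.1.6; [BushnellHenniart2006] §7.1, §12.4).  (§1) For `u(x,z) = (1 x z; 0 1 −σx; 0 0 1)` and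
`Φ₃ = antidiag(1,1,1)`: `Φ₃·u(x,z)·Φ₃ = n⁻(x,z) := (1 0 0; −σx 1 0; z x 1)` — conjugation by `Φ₃ = Φ₃⁻¹` reverses rows and columns (ring-generic, no relation between `x` and `z` needed).
(§2) Over a field `F` with a valuation `v` and a radius `c < 1`, with `K(c)` = ★ `valuedCongruenceSubgroup (Fin 3) c` (`g`, `g⁻¹` integral and `g ≡ 1 mod {v ≤ c}`) and `B` = the upper
triangular invertibles: a LOWER UNITRIANGULAR `g = (1 0 0; a 1 0; b d 1)` satisfies **`(∃ δ upper triangular invertible, δ·g ∈ K(c)) ⟺ v a ≤ c ∧ v b ≤ c ∧ v d ≤ c`**.  «⇐»: `δ = 1`,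
`g ∈ K(c)` (its inverse `(1 0 0; −a 1 0; ad−b −d 1)` is integral).  «⇒»: with `k = δ·g`, `δ₁₀ = δ₂₀ = δ₂₁ = 0`: last row of `k` = `δ₂₂·(b, d, 1)`, so `v(δ₂₂ − 1) ≤ c < 1` forces
`v δ₂₂ = 1` and then `v b = v k₂₀ ≤ c`, `v d = v k₂₁ ≤ c`; middle row of `k` = `(δ₁₁ a + δ₁₂ b, δ₁₁ + δ₁₂ d, δ₁₂)`, so `v δ₁₂ ≤ c`, `v(δ₁₁ − 1) ≤ max(c, v(δ₁₂ d)) < 1` forces `v δ₁₁ = 1`,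
and `v(δ₁₁ a) ≤ max(v k₁₀, v(δ₁₂ b)) ≤ c` gives `v a ≤ c`.  Since `B` is a group, `g ∈ B·K(c) ⟺ ∃ β ∈ B, β⁻¹ g ∈ K(c)` — §3 spells the criterion for any subgroup `H` of upper triangular
matrices (`g = β·k`, `β ∈ H`, `k ∈ K(c)`).  NO Iwasawa case split: the criterion holds ON and OFF the unit shell at once.  CONSEQUENCE (F-A32 (R1), for the consumer): at a level place
`v ∣ 𝔫` the (E-supp) section ★ `exists_finLevelSection_with_support` read at base point `w₀`, `p ↦ Φ_v(w₀·u(X,Z)·w₀)`, is `θ(1)·𝟙{|X|_w, |σX|_w, |Z|_w ≤ |𝔫|_w}` — a TEST WEIGHT on a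
ball where the local height is `1` (★ (a-4) `chiLocalMean_ne_zero_of_testWeight`, ★ p864169 `hA32_of_record_of_testWeights`).
* §1 `antidiag_mul_heis_mul_antidiag` (matrices), `val_antidiag_mul_heis_mul_antidiag` (`GL₃`).
* §2 `inv_val_lowerUnitriangular`, `lowerUnitriangular_mem_valuedCongruenceSubgroup` («⇐»), `valuation_le_of_upperTriangular_mul_lowerUnitriangular_mem` («⇒»),
  HEAD-2 `exists_upperTriangular_mul_mem_valuedCongruenceSubgroup_iff`.
* §3 HEAD-3 `lowerUnitriangular_mem_borel_mul_valuedCongruence_iff` — for any subgroup `H ≤ GL₃(F)` of upper triangular matrices: `(∃ β ∈ H, ∃ k ∈ K(c), g = β·k) ⟺ v a ≤ c ∧ v b ≤ c ∧ v d ≤ c`.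
HONEST SCOPE (census (E-cell) item 4): NOT here — the LOCAL–GLOBAL bridge «`u ∈ B_f·K_f(𝔫)` iff placewise» and the pure-tensor reading `hΩ` of the (E-supp) section, which belong to the
witness SECTION-FACTORISATION letter (`hfac hΩ hfin` of ★ (a-2b) at base point `ι_f(w₀^{S₀})`), the open core of `hsrc`∕`hUNF`.
HONEST LABEL: HC_CM is proved only modulo the 7 printed citations (2 remaining named inputs: hLiu418 = `stmt-HodgeConjecture-24832`, h413 = `stmt-HodgeConjecture-24833`) until rung 0
closes; REL ≠ ★ ≠ BUILT; this file asserts no named fact and closes no socket; unconditional matrix algebra and valuation bookkeeping; count-neutral.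

## References
* [Rogawski1990] J. D. Rogawski, *Automorphic Representations of Unitary Groups in Three Variables*, Ann. of Math. Stud. 123 (1990), §1.10 p. 9, §4.5 p. 45.
* [MoeglinWaldspurger1995] C. Mœglin, J.-L. Waldspurger, *Spectral Decomposition and Eisenstein Series* (1995), I.2.2, II.1.6.
* [BushnellHenniart2006] C. J. Bushnell, G. Henniart, *The Local Langlands Conjecture for GL(2)* (2006), §7.1, §12.4 (congruence subgroups).
-/

set_option autoImplicit false
set_option linter.dupNamespace false -- the mandated namespace repeats `HodgeConjecture.HodgeConjecture`

noncomputable section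

open Literature.NumberTheory.Automorphic

namespace Summit.HodgeConjecture.HodgeConjecture.Cruxes.H413.K2E1BigCellConjugateCongruenceU3

/-! ## §1 Ring-generic: `Φ₃ · u(x, z) · Φ₃ = n⁻(x, z)` is lower unitriangular -/

section RingGeneric

variable {R : Type*} [CommRing R] (σ : R →+* R)

/-- **`Φ₃ · u(x,z) · Φ₃ = (1 0 0; −σx 1 0; z x 1)`** (matrices): conjugating the Heisenberg element by the long Weyl element `Φ₃ = Φ₃⁻¹` reverses rows and columns; no relation between
`x` and `z` is used. [cite: Rogawski1990, §1.10 p. 9] -/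
theorem antidiag_mul_heis_mul_antidiag (x z : R) :
    (!![(0 : R), 0, 1; 0, 1, 0; 1, 0, 0] : Matrix (Fin 3) (Fin 3) R) * !![1, x, z; 0, 1, -σ x; 0, 0, 1] * !![(0 : R), 0, 1; 0, 1, 0; 1, 0, 0] =
      !![1, 0, 0; -σ x, 1, 0; z, x, 1] := by
  ext i j
  fin_cases i <;> fin_cases j <;> simp [Matrix.mul_apply, Fin.sum_univ_three, Matrix.cons_val_zero, Matrix.cons_val_one]

/-- The same for invertible matrices `w`, `n` of matrices `Φ₃`, `u(x,z)`: the matrix of `w·n·w` is `n⁻(x,z) = (1 0 0; −σx 1 0; z x 1)`. [cite: Rogawski1990, §1.10 p. 9] -/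
theorem val_antidiag_mul_heis_mul_antidiag {x z : R} {w n : GL (Fin 3) R} (hw : (w : Matrix (Fin 3) (Fin 3) R) = !![(0 : R), 0, 1; 0, 1, 0; 1, 0, 0])
    (hn : (n : Matrix (Fin 3) (Fin 3) R) = !![1, x, z; 0, 1, -σ x; 0, 0, 1]) :
    ((w * n * w : GL (Fin 3) R) : Matrix (Fin 3) (Fin 3) R) = !![1, 0, 0; -σ x, 1, 0; z, x, 1] := by
  rw [Units.val_mul, Units.val_mul, hw, hn]
  exact antidiag_mul_heis_mul_antidiag σ x z

end RingGeneric

/-! ## §2 The valued criterion for a lower unitriangular matrix -/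

section Valued

variable {F : Type*} [Field F] {Γ₀ : Type*} [LinearOrderedCommGroupWithZero Γ₀] [Valued F Γ₀]

/-- The inverse of the lower unitriangular `(1 0 0; a 1 0; b d 1)` is `(1 0 0; −a 1 0; ad − b  −d  1)`. [folklore] -/
theorem inv_val_lowerUnitriangular {a b d : F} {g : GL (Fin 3) F} (hg : (g : Matrix (Fin 3) (Fin 3) F) = !![1, 0, 0; a, 1, 0; b, d, 1]) :
    ((g⁻¹ : GL (Fin 3) F) : Matrix (Fin 3) (Fin 3) F) = !![1, 0, 0; -a, 1, 0; a * d - b, -d, 1] := by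
  refine Units.inv_eq_of_mul_eq_one_right ?_
  rw [hg]
  ext i j
  fin_cases i <;> fin_cases j <;> simp [Matrix.mul_apply, Fin.sum_univ_three, Matrix.cons_val_zero, Matrix.cons_val_one]
  all_goals ring

/-- **«⇐»: `(1 0 0; a 1 0; b d 1) ∈ K(c)` WHEN `v a, v b, v d ≤ c`** (`c < 1`): the matrix and its inverse are integral and `g − 1 = (0 0 0; a 0 0; b d 0)` has entries of valuation `≤ c`.
[cite: BushnellHenniart2006, §12.4] -/
theorem lowerUnitriangular_mem_valuedCongruenceSubgroup {c : Γ₀} (hc : c < 1) {a b d : F} (ha : Valued.v a ≤ c) (hb : Valued.v b ≤ c) (hd : Valued.v d ≤ c)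
    {g : GL (Fin 3) F} (hg : (g : Matrix (Fin 3) (Fin 3) F) = !![1, 0, 0; a, 1, 0; b, d, 1]) :
    g ∈ valuedCongruenceSubgroup (Fin 3) c := by
  have hc1 : c ≤ 1 := le_of_lt hc
  have ha1 : Valued.v a ≤ 1 := ha.trans hc1
  have hb1 : Valued.v b ≤ 1 := hb.trans hc1
  have hd1 : Valued.v d ≤ 1 := hd.trans hc1
  have hadb : Valued.v (a * d - b) ≤ 1 := by
    refine (Valued.v.map_sub _ _).trans (max_le ?_ hb1)
    rw [Valuation.map_mul]
    exact mul_le_one' ha1 hd1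
  refine (mem_valuedCongruenceSubgroup_iff (m := Fin 3)).2 ⟨fun i j => ?_, fun i j => ?_, fun i j => ?_⟩
  · rw [hg]
    fin_cases i <;> fin_cases j <;> simp [ha1, hb1, hd1]
  · rw [inv_val_lowerUnitriangular hg]
    fin_cases i <;> fin_cases j <;> simp [ha1, hd1, hadb]
  · rw [hg]
    fin_cases i <;> fin_cases j <;> simp [ha, hb, hd]

/-- **«⇒»: IF `δ·(1 0 0; a 1 0; b d 1) ∈ K(c)` FOR SOME UPPER TRIANGULAR `δ` THEN `v a, v b, v d ≤ c`** (`c < 1`).  With `k = δ·g`: last row `k₂ = δ₂₂·(b, d, 1)`, so `v(δ₂₂ − 1) ≤ c < 1`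
gives `v δ₂₂ = 1`, whence `v b = v k₂₀ ≤ c` and `v d = v k₂₁ ≤ c`; middle row `k₁ = (δ₁₁a + δ₁₂b, δ₁₁ + δ₁₂d, δ₁₂)`, so `v δ₁₂ ≤ c`, `v δ₁₁ = 1` (ultrametric), and `v(δ₁₁ a) ≤ max(v k₁₀, v(δ₁₂ b)) ≤ c`.
[cite: BushnellHenniart2006, §7.1, §12.4] -/
theorem valuation_le_of_upperTriangular_mul_lowerUnitriangular_mem {c : Γ₀} (hc : c < 1) {a b d : F}
    {g : GL (Fin 3) F} (hg : (g : Matrix (Fin 3) (Fin 3) F) = !![1, 0, 0; a, 1, 0; b, d, 1])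
    {δ : GL (Fin 3) F} (hδ : (δ : Matrix (Fin 3) (Fin 3) F).BlockTriangular id) (hk : δ * g ∈ valuedCongruenceSubgroup (Fin 3) c) :
    Valued.v a ≤ c ∧ Valued.v b ≤ c ∧ Valued.v d ≤ c := by
  obtain ⟨-, -, h3⟩ := (mem_valuedCongruenceSubgroup_iff (m := Fin 3)).1 hk
  have hδ10 : (δ : Matrix (Fin 3) (Fin 3) F) 1 0 = 0 := hδ (show (0 : Fin 3) < 1 by decide)
  have hδ20 : (δ : Matrix (Fin 3) (Fin 3) F) 2 0 = 0 := hδ (show (0 : Fin 3) < 2 by decide)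
  have hδ21 : (δ : Matrix (Fin 3) (Fin 3) F) 2 1 = 0 := hδ (show (1 : Fin 3) < 2 by decide)
  -- the entries of `k = δ·g` in rows 1 and 2
  have hk : ∀ i j, ((δ * g : GL (Fin 3) F) : Matrix (Fin 3) (Fin 3) F) i j = ∑ l, (δ : Matrix (Fin 3) (Fin 3) F) i l * (!![1, 0, 0; a, 1, 0; b, d, 1] : Matrix (Fin 3) (Fin 3) F) l j :=
    fun i j => by rw [Units.val_mul, hg, Matrix.mul_apply]
  have h20 : ((δ * g : GL (Fin 3) F) : Matrix (Fin 3) (Fin 3) F) 2 0 = (δ : Matrix (Fin 3) (Fin 3) F) 2 2 * b := by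
    rw [hk, Fin.sum_univ_three, hδ20, hδ21]; simp
  have h21 : ((δ * g : GL (Fin 3) F) : Matrix (Fin 3) (Fin 3) F) 2 1 = (δ : Matrix (Fin 3) (Fin 3) F) 2 2 * d := by
    rw [hk, Fin.sum_univ_three, hδ20, hδ21]; simp
  have h22 : ((δ * g : GL (Fin 3) F) : Matrix (Fin 3) (Fin 3) F) 2 2 = (δ : Matrix (Fin 3) (Fin 3) F) 2 2 := by
    rw [hk, Fin.sum_univ_three, hδ20, hδ21]; simp
  have h10 : ((δ * g : GL (Fin 3) F) : Matrix (Fin 3) (Fin 3) F) 1 0 = (δ : Matrix (Fin 3) (Fin 3) F) 1 1 * a + (δ : Matrix (Fin 3) (Fin 3) F) 1 2 * b := by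
    rw [hk, Fin.sum_univ_three, hδ10]; simp
  have h11 : ((δ * g : GL (Fin 3) F) : Matrix (Fin 3) (Fin 3) F) 1 1 = (δ : Matrix (Fin 3) (Fin 3) F) 1 1 + (δ : Matrix (Fin 3) (Fin 3) F) 1 2 * d := by
    rw [hk, Fin.sum_univ_three, hδ10]; simp
  have h12 : ((δ * g : GL (Fin 3) F) : Matrix (Fin 3) (Fin 3) F) 1 2 = (δ : Matrix (Fin 3) (Fin 3) F) 1 2 := by
    rw [hk, Fin.sum_univ_three, hδ10]; simp
  -- the congruence conditions `v((k − 1) i j) ≤ c`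
  have c20 := h3 2 0
  have c21 := h3 2 1
  have c22 := h3 2 2
  have c10 := h3 1 0
  have c11 := h3 1 1
  have c12 := h3 1 2
  simp only [Matrix.sub_apply, Matrix.one_apply] at c20 c21 c22 c10 c11 c12
  simp only [Fin.reduceEq, if_false, sub_zero, if_true] at c20 c21 c22 c10 c11 c12
  rw [h20] at c20
  rw [h21] at c21
  rw [h22] at c22
  rw [h10] at c10
  rw [h11] at c11
  rw [h12] at c12
  -- `v δ₂₂ = 1`
  have hδ22 : Valued.v ((δ : Matrix (Fin 3) (Fin 3) F) 2 2) = 1 := by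
    have h : Valued.v ((δ : Matrix (Fin 3) (Fin 3) F) 2 2 - 1) < 1 := lt_of_le_of_lt c22 hc
    have := Valued.v.map_add_eq_of_lt_left (x := (1 : F)) (y := (δ : Matrix (Fin 3) (Fin 3) F) 2 2 - 1) (by rwa [Valuation.map_one])
    rwa [add_sub_cancel, Valuation.map_one] at this
  have hb : Valued.v b ≤ c := by
    have := c20
    rwa [Valuation.map_mul, hδ22, one_mul] at this
  have hd : Valued.v d ≤ c := by
    have := c21
    rwa [Valuation.map_mul, hδ22, one_mul] at this
  -- `v δ₁₂ ≤ c`, `v δ₁₁ = 1`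
  have hδ12 : Valued.v ((δ : Matrix (Fin 3) (Fin 3) F) 1 2) ≤ c := c12
  -- `c·c ≤ c`
  have hcc : c * c ≤ c := by
    calc c * c ≤ c * 1 := mul_le_mul_right (le_of_lt hc) c
      _ = c := mul_one c
  have hδ11 : Valued.v ((δ : Matrix (Fin 3) (Fin 3) F) 1 1) = 1 := by
    have h1 : Valued.v ((δ : Matrix (Fin 3) (Fin 3) F) 1 1 - 1) ≤ c := by
      have heq : (δ : Matrix (Fin 3) (Fin 3) F) 1 1 - 1 = ((δ : Matrix (Fin 3) (Fin 3) F) 1 1 + (δ : Matrix (Fin 3) (Fin 3) F) 1 2 * d - 1) - (δ : Matrix (Fin 3) (Fin 3) F) 1 2 * d := by ring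
      rw [heq]
      refine (Valued.v.map_sub _ _).trans (max_le c11 ?_)
      rw [Valuation.map_mul]
      exact (mul_le_mul' hδ12 hd).trans hcc
    have h : Valued.v ((δ : Matrix (Fin 3) (Fin 3) F) 1 1 - 1) < 1 := lt_of_le_of_lt h1 hc
    have := Valued.v.map_add_eq_of_lt_left (x := (1 : F)) (y := (δ : Matrix (Fin 3) (Fin 3) F) 1 1 - 1) (by rwa [Valuation.map_one])
    rwa [add_sub_cancel, Valuation.map_one] at this
  have ha : Valued.v a ≤ c := by
    have h1 : Valued.v ((δ : Matrix (Fin 3) (Fin 3) F) 1 1 * a) ≤ c := by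
      have heq : (δ : Matrix (Fin 3) (Fin 3) F) 1 1 * a = ((δ : Matrix (Fin 3) (Fin 3) F) 1 1 * a + (δ : Matrix (Fin 3) (Fin 3) F) 1 2 * b) - (δ : Matrix (Fin 3) (Fin 3) F) 1 2 * b := by ring
      rw [heq]
      refine (Valued.v.map_sub _ _).trans (max_le c10 ?_)
      rw [Valuation.map_mul]
      exact (mul_le_mul' hδ12 hb).trans hcc
    rwa [Valuation.map_mul, hδ11, one_mul] at h1
  exact ⟨ha, hb, hd⟩

/-- **HEAD-2.  THE VALUED CRITERION**: for `c < 1` and a lower unitriangular `g = (1 0 0; a 1 0; b d 1)`,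
`(∃ δ ∈ GL₃(F) upper triangular, δ·g ∈ K(c)) ⟺ v a ≤ c ∧ v b ≤ c ∧ v d ≤ c` (§2 «⇒»; «⇐» with `δ = 1`). [cite: BushnellHenniart2006, §7.1, §12.4] [cite: Rogawski1990, §4.5 p. 45] -/
theorem exists_upperTriangular_mul_mem_valuedCongruenceSubgroup_iff {c : Γ₀} (hc : c < 1) {a b d : F}
    {g : GL (Fin 3) F} (hg : (g : Matrix (Fin 3) (Fin 3) F) = !![1, 0, 0; a, 1, 0; b, d, 1]) :
    (∃ δ : GL (Fin 3) F, (δ : Matrix (Fin 3) (Fin 3) F).BlockTriangular id ∧ δ * g ∈ valuedCongruenceSubgroup (Fin 3) c) ↔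
      (Valued.v a ≤ c ∧ Valued.v b ≤ c ∧ Valued.v d ≤ c) := by
  refine ⟨fun ⟨δ, hδ, hk⟩ => valuation_le_of_upperTriangular_mul_lowerUnitriangular_mem hc hg hδ hk, fun ⟨ha, hb, hd⟩ => ⟨1, ?_, ?_⟩⟩
  · rw [Units.val_one]
    exact Matrix.blockTriangular_one
  · rw [one_mul]
    exact lowerUnitriangular_mem_valuedCongruenceSubgroup hc ha hb hd hg

/-! ## §3 HEAD: membership of `n⁻` in `B·K(c)` for a subgroup `B` of upper triangular matrices -/

/-- **HEAD-3.  `(1 0 0; a 1 0; b d 1) ∈ H·K(c) ⟺ v a ≤ c ∧ v b ≤ c ∧ v d ≤ c`** for every subgroup `H ≤ GL₃(F)` of upper triangular matrices (e.g. a Borel subgroup) and `c < 1`: if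
`g = β·k` with `β ∈ H`, `k ∈ K(c)` then `δ := β⁻¹ ∈ H` is upper triangular with `δ·g = k` (§2 «⇒»); conversely `g = 1·g` with `g ∈ K(c)` (§2 «⇐»).  The big-cell reading at base point
`w₀` (§1): the (E-supp) section's weight at a level place is the indicator of the `c`-ball. [cite: BushnellHenniart2006, §7.1, §12.4] [cite: Rogawski1990, §1.10 p. 9, §4.5 p. 45] [cite: MoeglinWaldspurger1995, II.1.6] -/
theorem lowerUnitriangular_mem_borel_mul_valuedCongruence_iff {c : Γ₀} (hc : c < 1) (H : Subgroup (GL (Fin 3) F))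
    (hH : ∀ β ∈ H, (β : Matrix (Fin 3) (Fin 3) F).BlockTriangular id) {a b d : F}
    {g : GL (Fin 3) F} (hg : (g : Matrix (Fin 3) (Fin 3) F) = !![1, 0, 0; a, 1, 0; b, d, 1]) :
    (∃ β ∈ H, ∃ k ∈ valuedCongruenceSubgroup (F := F) (Fin 3) c, g = β * k) ↔ (Valued.v a ≤ c ∧ Valued.v b ≤ c ∧ Valued.v d ≤ c) := by
  refine ⟨fun ⟨β, hβ, k, hk, hgk⟩ => ?_, fun h => ⟨1, H.one_mem, g, lowerUnitriangular_mem_valuedCongruenceSubgroup hc h.1 h.2.1 h.2.2 hg, (one_mul g).symm⟩⟩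
  refine valuation_le_of_upperTriangular_mul_lowerUnitriangular_mem hc hg (hH _ (H.inv_mem hβ)) (δ := β⁻¹) ?_
  rw [hgk, inv_mul_cancel_left]
  exact hk

end Valued

end Summit.HodgeConjecture.HodgeConjecture.Cruxes.H413.K2E1BigCellConjugateCongruenceU3

end
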